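import Summits.QuantumFields.YangMills.Theorems.VirialFluxGapRegularValleyNearestZero
import Summits.QuantumFields.YangMills.Theorems.VirialFluxGapRegularValleyAxis
import Summits.QuantumFields.YangMills.Theorems.VirialFluxGapValleyCombFamily
import Summits.QuantumFields.YangMills.Theorems.LuscherReductionRunningReductionAxialGaugeInner
import HarnessLib

/-!
# Route `VirialFluxGap` (YangMills): the EXPLICIT COMB BASE POINT near a regular ring history — comb data on one axis, and on `X_fix`

Taylor base point for the generic chart of the ⟨stmt-QuantumFields-24141⟩ `PeriodicSoftness` Euler field (LEAD ruling 2026-08-30T23:30Z: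
host `X_fix`; assignment (K) «+ the explicit flat comb ring of ✓p794572 as Taylor base point»).  ✓`exists_zero_near_of_regular` hides the
comb data behind `∃ Q`; the kernel vectors of ✓`VirialFluxGapSheetKernelFix` need them EXPOSED and ON ONE AXIS.  Here:

* ★★ `exists_comb_near_of_far_axis` — for a `ρ`-regular ring history `P` (pivot wrap representative or seam value with `|Im q|² ≥ ρ²`):
  a unit axis `n = (n₁,n₂,n₃)`, comb data `h' : Fin 3 → SU2`, `c' : SU2` with `Im su2Quat(h' j) = th_j·n`, `Im su2Quat(c') = tc·n`, such that
  the comb ring `R(t,h',c') = (every slice t⁻¹·combFlat h', seam x ↦ (t x)⁻¹ c' (t x))`, `t = treeGauge (P.1 0)`, is FLAT and within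
  `fd ≤ 4L√F₀ + 12L²√F₀ + 40L²√F₀/ρ` (slices) ∕ `12L²√F₀ + 40L²√F₀/ρ` (seam) of `P` — the proof of ✓`exists_flat_ring_near_of_far` run with
  ✓`exists_commuting_near_of_far_axis` in place of ✓`exists_commuting_near_of_norm_comm_le_of_far`;
* `sum_dist_le_of_fd_le` — the per-variable bounds give the total chordal distance `D(P,Q) ≤ 21520·L⁸·F₀(P)/ρ²` (as in ✓p794572);
* ★★ `exists_comb_near_of_regular_of_treeGauge_eq_one` — when slice `0` of `P` is in comb gauge (`treeGauge (P.1 0) = 1`; e.g. every point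
  of the tree-gauged space `X_fix`, `treeGauge_cons_glue`), the nearby flat ring IS the plain comb point `((fun _ => combFlat h'), fun _ => c')`
  of ✓`VirialFluxGapSheetKernel` ∕ ✓`…SheetKernelFix`, with the fd bounds and `D ≤ 21520·L⁸·F₀(P)/ρ²`.

HONEST FRAMING: helper algebra (re-packaging of ✓`VirialFluxGapRegularValleyLocalise` ∕ ✓`…NearestZero` with the axis exposed); ⟨24141⟩ and
⟨22884⟩ stay OPEN; no stub ∕ crux ∕ rung ∕ summit is closed; the Yang–Mills mass gap is NOT proved; no summit is proved by a line.  No definitions,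
0 `sorry`, standard axioms.  Width seat `ym-line-sfw-p2-w2` g51 (cell ym-idea-1, free hands), `--supports stmt-QuantumFields-24141`.
References: [cite: Luscher1983, §2] (toron valley), [folklore].
-/

noncomputable section

open scoped Quaternion Matrix BigOperators
open Literature.MathematicalPhysics.QuantumFieldTheory hiding SU2
open Literature.MathematicalPhysics.QuantumLattice

namespace Summit.QuantumFields.YangMills.Theorems.VirialFluxGap.RegularValley

open Summit.QuantumFields.YangMills.Theorems.FemtoTransferGap
open Summit.QuantumFields.YangMills.Theorems.FemtoTransferGap.TT
open Summit.QuantumFields.YangMills.Theorems.FemtoTransferGap.TwoLattice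
open Summit.QuantumFields.YangMills.Theorems.FemtoTransferGap.TwoLattice.Flat
open Summit.QuantumFields.YangMills.Theorems.VirialFluxGap.RingDeficit
open Summit.QuantumFields.YangMills.Theorems.ToronValleyVolume.Lojasiewicz

variable {L : ℕ} [NeZero L]

/-! ## §1 The comb data near a regular ring history, on one axis -/

/-- ★★ **Comb data on one axis near a regular ring history.**  Same construction as ✓`exists_flat_ring_near_of_far`, with the commuting
quadruple taken ON THE AXIS of the regular pivot (✓`exists_commuting_near_of_far_axis`) and the data `(n, th, tc, h', c')` exposed; the
gauge field of the comb ring is `t = treeGauge (P.1 0)`. [cite: Luscher1983, §2] -/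
theorem exists_comb_near_of_far_axis (P : (Fin (2 * L - 1 + 1) → GaugeConfig 3 L SU2) × (Site 3 L → SU2)) {ρ : ℝ} (hρ : 0 < ρ)
    (hfar : (∃ k : Fin 3, ρ ^ 2 ≤ ((su2Quat (wrapReps (P.1 0) k)).imI * (su2Quat (wrapReps (P.1 0) k)).imI +
        (su2Quat (wrapReps (P.1 0) k)).imJ * (su2Quat (wrapReps (P.1 0) k)).imJ + (su2Quat (wrapReps (P.1 0) k)).imK * (su2Quat (wrapReps (P.1 0) k)).imK)) ∨
      ρ ^ 2 ≤ ((su2Quat (P.2 0)).imI * (su2Quat (P.2 0)).imI + (su2Quat (P.2 0)).imJ * (su2Quat (P.2 0)).imJ +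
        (su2Quat (P.2 0)).imK * (su2Quat (P.2 0)).imK)) :
    ∃ (n₁ n₂ n₃ : ℝ) (th : Fin 3 → ℝ) (tc : ℝ) (h' : Fin 3 → SU2) (c' : SU2),
      n₁ ^ 2 + n₂ ^ 2 + n₃ ^ 2 = 1 ∧
      (∀ j, (su2Quat (h' j)).imI = th j * n₁ ∧ (su2Quat (h' j)).imJ = th j * n₂ ∧ (su2Quat (h' j)).imK = th j * n₃) ∧
      ((su2Quat c').imI = tc * n₁ ∧ (su2Quat c').imJ = tc * n₂ ∧ (su2Quat c').imK = tc * n₃) ∧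
      ringDeficit L (fun _ => false)
        ((fun _ => gaugeTransform (treeGauge (P.1 0))⁻¹ (combFlat h')), fun x => (treeGauge (P.1 0) x)⁻¹ * c' * treeGauge (P.1 0) x) = 0 ∧
      (∀ (i : Fin (2 * L - 1 + 1)) (e : Edge 3 L), fd (P.1 i e) (gaugeTransform (treeGauge (P.1 0))⁻¹ (combFlat h') e) ≤
        4 * (L : ℝ) * Real.sqrt (ringDeficit L (fun _ => false) P) + 12 * (L : ℝ) ^ 2 * Real.sqrt (ringDeficit L (fun _ => false) P) +
          40 * (L : ℝ) ^ 2 * Real.sqrt (ringDeficit L (fun _ => false) P) / ρ) ∧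
      (∀ x : Site 3 L, fd (P.2 x) ((treeGauge (P.1 0) x)⁻¹ * c' * treeGauge (P.1 0) x) ≤
        12 * (L : ℝ) ^ 2 * Real.sqrt (ringDeficit L (fun _ => false) P) + 40 * (L : ℝ) ^ 2 * Real.sqrt (ringDeficit L (fun _ => false) P) / ρ) := by
  set δ := Real.sqrt (ringDeficit L (fun _ => false) P) with hδ
  have hδ0 : 0 ≤ δ := Real.sqrt_nonneg _
  have hL1 : (1 : ℝ) ≤ L := by exact_mod_cast NeZero.one_le
  have hL0 : (0 : ℝ) ≤ (L : ℝ) - 1 := by linarith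
  set U : GaugeConfig 3 L SU2 := P.1 0 with hU
  set g : Site 3 L → SU2 := P.2 with hg
  set ρ' : ℝ := 4 * (L : ℝ) * δ with hρ'
  have hρ'0 : 0 ≤ ρ' := by positivity
  have hslice : ∀ i e, fd (P.1 i e) (U e) ≤ 4 * (L : ℝ) * δ := fun i e => fd_slice_zero_le' P i e
  have hseam : ∀ e, fd (U e) (gaugeTransform g U e) ≤ ρ' := fun e => fd_seam_zero_le P e
  have hS : Real.sqrt (2 * wilsonAction su2Rep U) ≤ 2 * δ := sqrt_two_action_le P
  set t : Site 3 L → SU2 := treeGauge U with ht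
  have hV : treeFix U = gaugeTransform t U := rfl
  set w : Fin 3 → SU2 := wrapReps U with hw
  have hVw : ∀ e, fd (treeFix U e) (combFlat w e) ≤ 12 * (L : ℝ) ^ 2 * δ := fun e => by
    refine (fd_treeFix_combFlat_le U e).trans ?_
    have h1 : ((L : ℝ) - 1) * ((6 * (L : ℝ) - 4) * Real.sqrt (2 * wilsonAction su2Rep U)) ≤ ((L : ℝ) - 1) * ((6 * (L : ℝ) - 4) * (2 * δ)) :=
      mul_le_mul_of_nonneg_left (mul_le_mul_of_nonneg_left hS (by linarith)) hL0
    nlinarith [h1]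
  have hww : ∀ i j, fd (w i * w j * (w i)⁻¹ * (w j)⁻¹) 1 ≤ 20 * (L : ℝ) ^ 2 * δ := fun i j => by
    refine (fd_comm_wrapReps_le U i j).trans ?_
    have hC : combC L ≤ 10 * (L : ℝ) ^ 2 := by unfold combC; nlinarith
    have hC0 : 0 ≤ combC L := le_trans zero_le_one one_le_combC
    calc combC L * Real.sqrt (2 * wilsonAction su2Rep U) ≤ combC L * (2 * δ) := mul_le_mul_of_nonneg_left hS hC0
      _ ≤ 10 * (L : ℝ) ^ 2 * (2 * δ) := mul_le_mul_of_nonneg_right hC (by positivity)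
      _ = 20 * (L : ℝ) ^ 2 * δ := by ring
  set s : Site 3 L → SU2 := fun x => t x * g x * (t x)⁻¹ with hs
  have hsV : ∀ e, fd (treeFix U e) (gaugeTransform s (treeFix U) e) ≤ ρ' := fun e => by
    rw [hV, hs, gaugeTransform_conj_eq, fd_gaugeTransform_apply]; exact hseam e
  have hjump : ∀ e : Edge 3 L, treeEdge e = true → fd (s (e.1.shift e.2)) (s e.1) ≤ ρ' := by
    intro e he
    have h1 := hsV e
    rw [treeFix_eq_one_of_treeEdge U he] at h1
    have e1 : gaugeTransform s (treeFix U) e = s e.1 * (s (e.1.shift e.2))⁻¹ := by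
      rw [show gaugeTransform s (treeFix U) e = s e.1 * treeFix U e * (s (e.1.shift e.2))⁻¹ from rfl, treeFix_eq_one_of_treeEdge U he, mul_one]
    rw [e1, fd_comm, fd_mul_inv_one] at h1
    rwa [fd_comm]
  set c : SU2 := s 0 with hc
  have hcg : c = g 0 := by rw [hc, hs]; dsimp only; rw [ht, treeGauge_zero, one_mul, inv_one, mul_one]
  have hsc : ∀ x, fd (s x) c ≤ 3 * ((L : ℝ) - 1) * ρ' := fun x => by
    have := fd_sub_base_le_of_treeEdge hρ'0 hjump x
    rwa [hc]
  have hcw : ∀ k : Fin 3, fd (c * w k * c⁻¹ * (w k)⁻¹) 1 ≤ 12 * (L : ℝ) ^ 2 * δ := by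
    intro k
    set m : Site 3 L := mk3 (if k = 0 then (-1 : ZMod L) else 0) (if k = 1 then (-1 : ZMod L) else 0) (if k = 2 then (-1 : ZMod L) else 0) with hm
    have hwk : w k = treeFix U (m, k) := by rw [hw, wrapReps_eq]
    have hshift : m.shift k = 0 := wrapEdge_shift k
    have h1 := hsV (m, k)
    have e1 : gaugeTransform s (treeFix U) (m, k) = s m * treeFix U (m, k) * c⁻¹ := by
      rw [show gaugeTransform s (treeFix U) (m, k) = s m * treeFix U (m, k) * (s (m.shift k))⁻¹ from rfl, hshift]
    rw [e1, ← hwk] at h1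
    have h2 : fd (s m * w k * c⁻¹) (c * w k * c⁻¹) = fd (s m) c := by rw [fd_mul_right, fd_mul_right]
    have h3 := hsc m
    rw [fd_mul_inv_one, fd_comm]
    calc fd (w k) (c * w k * c⁻¹) ≤ fd (w k) (s m * w k * c⁻¹) + fd (s m * w k * c⁻¹) (c * w k * c⁻¹) := fd_triangle _ _ _
      _ ≤ ρ' + 3 * ((L : ℝ) - 1) * ρ' := by rw [h2]; exact add_le_add h1 h3
      _ ≤ 12 * (L : ℝ) ^ 2 * δ := by rw [hρ']; nlinarith
  let X : Option (Fin 3) → SU2 := fun o => Option.elim o c w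
  have hXs : ∀ k : Fin 3, X (some k) = w k := fun k => rfl
  have hXn : X none = c := rfl
  have hinv : ∀ a b : SU2, fd (b * a * b⁻¹ * a⁻¹) 1 = fd (a * b * a⁻¹ * b⁻¹) 1 := fun a b => by
    rw [show b * a * b⁻¹ * a⁻¹ = (a * b * a⁻¹ * b⁻¹)⁻¹ by group, ← fd_inv, inv_inv, inv_one]
  have hcomm : ∀ i j, ‖su2Quat (X i) * su2Quat (X j) - su2Quat (X j) * su2Quat (X i)‖ ≤ 20 * (L : ℝ) ^ 2 * δ := by
    intro i j
    refine (norm_quat_comm_le_fd (X i) (X j)).trans ?_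
    rcases i with _ | i <;> rcases j with _ | j
    · rw [hXn, mul_inv_cancel_right, mul_inv_cancel, fd_self]; positivity
    · rw [hXn, hXs]; exact (hcw j).trans (by nlinarith)
    · rw [hXn, hXs, hinv]; exact (hcw i).trans (by nlinarith)
    · rw [hXs, hXs]; exact hww i j
  have hη0 : 0 ≤ 20 * (L : ℝ) ^ 2 * δ := by positivity
  obtain ⟨o₀, ho₀⟩ : ∃ o₀ : Option (Fin 3), ρ ^ 2 ≤ ((su2Quat (X o₀)).imI * (su2Quat (X o₀)).imI +
      (su2Quat (X o₀)).imJ * (su2Quat (X o₀)).imJ + (su2Quat (X o₀)).imK * (su2Quat (X o₀)).imK) := by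
    rcases hfar with ⟨k, hk⟩ | h0
    · exact ⟨some k, by rw [hXs, hw, hU]; exact hk⟩
    · exact ⟨none, by rw [hXn, hcg, hg]; exact h0⟩
  -- the commuting quadruple ON THE AXIS of the pivot
  obtain ⟨n₁, n₂, n₃, τ, y, hn, hyax, hy1, hyc, hyd⟩ :=
    exists_commuting_near_of_far_axis (fun o => su2Quat (X o)) hη0 hρ (fun o => norm_su2Quat _) hcomm o₀ ho₀
  obtain ⟨Y, hYq, hYc⟩ := exists_su2_family_of_unit_quaternions y hy1
  have hYcomm : ∀ i j, Y i * Y j = Y j * Y i := fun i j => hYc i j (hyc i j)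
  have hXY : ∀ o, fd (X o) (Y o) ≤ 40 * (L : ℝ) ^ 2 * δ / ρ := fun o => by
    refine (fd_le_two_mul_norm_su2Quat_sub (X o) (Y o)).trans ?_
    rw [hYq]
    have := hyd o
    have e : 40 * (L : ℝ) ^ 2 * δ / ρ = 2 * (20 * (L : ℝ) ^ 2 * δ / ρ) := by ring
    rw [e]; linarith
  set h' : Fin 3 → SU2 := fun k => Y (some k) with hh'
  set c' : SU2 := Y none with hc'
  have hh'c : ∀ i j, h' i * h' j = h' j * h' i := fun i j => hYcomm _ _
  have hc'h : ∀ k, c' * h' k = h' k * c' := fun k => hYcomm _ _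
  refine ⟨n₁, n₂, n₃, fun k => τ (some k), τ none, h', c', hn, fun j => ?_, ?_, ringDeficit_combRing_eq_zero t hh'c hc'h, ?_, ?_⟩
  · show (su2Quat (Y (some j))).imI = _ ∧ (su2Quat (Y (some j))).imJ = _ ∧ (su2Quat (Y (some j))).imK = _
    rw [hYq]; exact hyax _
  · show (su2Quat (Y none)).imI = _ ∧ (su2Quat (Y none)).imJ = _ ∧ (su2Quat (Y none)).imK = _
    rw [hYq]; exact hyax _
  · -- slices
    intro i e
    set F : GaugeConfig 3 L SU2 := combFlat h' with hF
    have e1 : fd (P.1 i e) (gaugeTransform t⁻¹ F e) = fd (gaugeTransform t (P.1 i) e) (F e) := by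
      have h := fd_gaugeTransform_apply t (P.1 i) (gaugeTransform t⁻¹ F) e
      rw [gaugeTransform_gaugeTransform_inv] at h
      exact h.symm
    rw [e1]
    have h1 : fd (gaugeTransform t (P.1 i) e) (gaugeTransform t U e) ≤ 4 * (L : ℝ) * δ := by rw [fd_gaugeTransform_apply]; exact hslice i e
    have h2 := hVw e
    have h3 : fd (combFlat w e) (F e) ≤ 40 * (L : ℝ) ^ 2 * δ / ρ := by
      rw [hF, combFlat_apply, combFlat_apply]
      split_ifs with hx
      · have := hXY (some e.2); rwa [hXs] at this
      · rw [fd_self]; positivity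
    calc fd (gaugeTransform t (P.1 i) e) (F e)
        ≤ fd (gaugeTransform t (P.1 i) e) (gaugeTransform t U e) + (fd (gaugeTransform t U e) (combFlat w e) + fd (combFlat w e) (F e)) :=
          (fd_triangle _ _ _).trans (add_le_add le_rfl (fd_triangle _ _ _))
      _ ≤ 4 * (L : ℝ) * δ + (12 * (L : ℝ) ^ 2 * δ + 40 * (L : ℝ) ^ 2 * δ / ρ) := add_le_add h1 (add_le_add (hV ▸ h2) h3)
      _ = 4 * (L : ℝ) * δ + 12 * (L : ℝ) ^ 2 * δ + 40 * (L : ℝ) ^ 2 * δ / ρ := by ring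
  · -- seam
    intro x
    have e0 : t x * ((t x)⁻¹ * c' * t x) * (t x)⁻¹ = c' := by
      simp only [mul_assoc, mul_inv_cancel_left, mul_inv_cancel, mul_one]
    have e1 : fd (g x) ((t x)⁻¹ * c' * t x) = fd (s x) c' := by
      rw [hs]; dsimp only
      conv_rhs => rw [← e0]
      rw [fd_mul_right, fd_mul_left]
    rw [e1]
    have h1 := hsc x
    have h2 : fd c c' = fd (X none) (Y none) := rfl
    have h3 := hXY none
    calc fd (s x) c' ≤ fd (s x) c + fd c c' := fd_triangle _ _ _
      _ ≤ 3 * ((L : ℝ) - 1) * ρ' + 40 * (L : ℝ) ^ 2 * δ / ρ := add_le_add h1 (h2 ▸ h3)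
      _ ≤ 12 * (L : ℝ) ^ 2 * δ + 40 * (L : ℝ) ^ 2 * δ / ρ := by rw [hρ']; nlinarith

/-! ## §2 The total chordal distance from the per-variable bounds -/

/-- The per-variable `fd` bounds of the nearby flat ring give the total chordal distance `D(P,Q) ≤ 21520·L⁸·F₀(P)/ρ²` (`0 < ρ ≤ 1`). [folklore] -/
theorem sum_dist_le_of_fd_le (P Q : (Fin (2 * L - 1 + 1) → GaugeConfig 3 L SU2) × (Site 3 L → SU2)) {ρ : ℝ} (hρ : 0 < ρ) (hρ1 : ρ ≤ 1)
    (hQ1 : ∀ (i : Fin (2 * L - 1 + 1)) (e : Edge 3 L), fd (P.1 i e) (Q.1 i e) ≤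
        4 * (L : ℝ) * Real.sqrt (ringDeficit L (fun _ => false) P) + 12 * (L : ℝ) ^ 2 * Real.sqrt (ringDeficit L (fun _ => false) P) +
          40 * (L : ℝ) ^ 2 * Real.sqrt (ringDeficit L (fun _ => false) P) / ρ)
    (hQ2 : ∀ x : Site 3 L, fd (P.2 x) (Q.2 x) ≤
        12 * (L : ℝ) ^ 2 * Real.sqrt (ringDeficit L (fun _ => false) P) + 40 * (L : ℝ) ^ 2 * Real.sqrt (ringDeficit L (fun _ => false) P) / ρ) :
    (∑ i : Fin (2 * L - 1 + 1), (6 * (L : ℝ) ^ 3 - timeCoupling su2Rep (P.1 i) (Q.1 i))) +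
        ∑ x : Site 3 L, (2 - ((su2Rep (P.2 x * (Q.2 x)⁻¹)).trace).re) ≤
      21520 * (L : ℝ) ^ 8 * ringDeficit L (fun _ => false) P / ρ ^ 2 := by
  set ε := ringDeficit L (fun _ => false) P with hε
  have hε0 : 0 ≤ ε := ringDeficit_nonneg _ _
  have hL1 : (1 : ℝ) ≤ L := by exact_mod_cast NeZero.one_le
  set δ := Real.sqrt ε with hδ
  have hδ0 : 0 ≤ δ := Real.sqrt_nonneg _
  have hδ2 : δ ^ 2 = ε := Real.sq_sqrt hε0
  set B₁ := 4 * (L : ℝ) * δ + 12 * (L : ℝ) ^ 2 * δ + 40 * (L : ℝ) ^ 2 * δ / ρ with hB₁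
  set B₂ := 12 * (L : ℝ) ^ 2 * δ + 40 * (L : ℝ) ^ 2 * δ / ρ with hB₂
  have hs1 : ∀ i : Fin (2 * L - 1 + 1), 6 * (L : ℝ) ^ 3 - timeCoupling su2Rep (P.1 i) (Q.1 i) ≤ 3 * (L : ℝ) ^ 3 * B₁ ^ 2 := fun i => by
    rw [timeCoupling_deficit_eq]
    calc ∑ e : Edge 3 L, ‖su2Quat (P.1 i e) - su2Quat (Q.1 i e)‖ ^ 2 ≤ ∑ _e : Edge 3 L, B₁ ^ 2 :=
          Finset.sum_le_sum fun e _ => (pow_le_pow_left₀ (norm_nonneg _) (norm_su2Quat_sub_le_fd _ _) 2).trans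
            (pow_le_pow_left₀ (frobNorm_nonneg _) (hQ1 i e) 2)
      _ = 3 * (L : ℝ) ^ 3 * B₁ ^ 2 := by rw [Finset.sum_const, Finset.card_univ, nsmul_eq_mul, ConstTube.card_edge_three L]
  have hs2 : ∀ x : Site 3 L, 2 - ((su2Rep (P.2 x * (Q.2 x)⁻¹)).trace).re ≤ B₂ ^ 2 := fun x => by
    rw [ConstTube.re_trace_su2Rep_mul_inv_eq_norm]
    have := (pow_le_pow_left₀ (norm_nonneg _) (norm_su2Quat_sub_le_fd (P.2 x) (Q.2 x)) 2).trans
      (pow_le_pow_left₀ (frobNorm_nonneg _) (hQ2 x) 2)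
    linarith
  have hcardI : (Fintype.card (Fin (2 * L - 1 + 1)) : ℝ) = 2 * (L : ℝ) := by
    rw [Fintype.card_fin]
    have hL : 1 ≤ L := NeZero.one_le
    rw [show 2 * L - 1 + 1 = 2 * L by omega]; push_cast; ring
  have hcardS : (Fintype.card (Site 3 L) : ℝ) = (L : ℝ) ^ 3 := by
    rw [Fintype.card_pi, Finset.prod_const, Finset.card_univ, Fintype.card_fin, ZMod.card]; push_cast; ring
  have hA : (∑ i : Fin (2 * L - 1 + 1), (6 * (L : ℝ) ^ 3 - timeCoupling su2Rep (P.1 i) (Q.1 i))) ≤ 2 * (L : ℝ) * (3 * (L : ℝ) ^ 3) * B₁ ^ 2 := by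
    calc (∑ i : Fin (2 * L - 1 + 1), (6 * (L : ℝ) ^ 3 - timeCoupling su2Rep (P.1 i) (Q.1 i))) ≤ ∑ _i : Fin (2 * L - 1 + 1), 3 * (L : ℝ) ^ 3 * B₁ ^ 2 :=
          Finset.sum_le_sum fun i _ => hs1 i
      _ = 2 * (L : ℝ) * (3 * (L : ℝ) ^ 3) * B₁ ^ 2 := by rw [Finset.sum_const, Finset.card_univ, nsmul_eq_mul, hcardI]; ring
  have hB : ∑ x : Site 3 L, (2 - ((su2Rep (P.2 x * (Q.2 x)⁻¹)).trace).re) ≤ (L : ℝ) ^ 3 * B₂ ^ 2 := by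
    calc ∑ x : Site 3 L, (2 - ((su2Rep (P.2 x * (Q.2 x)⁻¹)).trace).re) ≤ ∑ _x : Site 3 L, B₂ ^ 2 := Finset.sum_le_sum fun x _ => hs2 x
      _ = (L : ℝ) ^ 3 * B₂ ^ 2 := by rw [Finset.sum_const, Finset.card_univ, nsmul_eq_mul, hcardS]
  have harith := constants_arith_far hL1 hδ0 hρ hρ1
  rw [← hB₁, ← hB₂, hδ2] at harith
  linarith

/-! ## §3 In comb gauge (e.g. on `X_fix`) the base point is the plain comb point -/

omit [NeZero L] in
/-- Slice `0` of an embedded `X_fix` point is in comb gauge: `treeGauge (glue w) = 1`. [folklore] -/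
theorem treeGauge_cons_glue [NeZero L] (w : OffIdx L → SU2) (f : Fin (2 * L - 1) → GaugeConfig 3 L SU2) :
    treeGauge ((Fin.cons (glue w) f : Fin (2 * L - 1 + 1) → GaugeConfig 3 L SU2) 0) = 1 := by
  funext x
  rw [Fin.cons_zero, treeGauge_glue, Pi.one_apply]

/-- ★★ **The comb base point of a regular ring history in comb gauge.**  If slice `0` of `P` is in comb gauge (`treeGauge (P.1 0) = 1`) and
`P` is `ρ`-regular (`0 < ρ`; pivot `1 − Re² ≥ ρ²` at a wrap representative or at the seam value `P.2 0`), there are a unit axis and comb data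
`h', c'` on it such that the plain comb point `((fun _ => combFlat h'), fun _ => c')` is flat, per-variable close to `P`
(`fd ≤ 4L√F₀ + 12L²√F₀ + 40L²√F₀/ρ` resp. `12L²√F₀ + 40L²√F₀/ρ`) and at total chordal distance `≤ 21520·L⁸·F₀(P)/ρ²`. [cite: Luscher1983, §2] -/
theorem exists_comb_near_of_regular_of_treeGauge_eq_one (P : (Fin (2 * L - 1 + 1) → GaugeConfig 3 L SU2) × (Site 3 L → SU2))
    (ht : treeGauge (P.1 0) = 1) {ρ : ℝ} (hρ : 0 < ρ)
    (hfar : (∃ k : Fin 3, ρ ^ 2 ≤ 1 - (su2Quat (wrapReps (P.1 0) k)).re ^ 2) ∨ ρ ^ 2 ≤ 1 - (su2Quat (P.2 0)).re ^ 2) :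
    ∃ (n₁ n₂ n₃ : ℝ) (th : Fin 3 → ℝ) (tc : ℝ) (h' : Fin 3 → SU2) (c' : SU2),
      n₁ ^ 2 + n₂ ^ 2 + n₃ ^ 2 = 1 ∧
      (∀ j, (su2Quat (h' j)).imI = th j * n₁ ∧ (su2Quat (h' j)).imJ = th j * n₂ ∧ (su2Quat (h' j)).imK = th j * n₃) ∧
      ((su2Quat c').imI = tc * n₁ ∧ (su2Quat c').imJ = tc * n₂ ∧ (su2Quat c').imK = tc * n₃) ∧
      ringDeficit L (fun _ => false) (((fun _ => combFlat h'), fun _ => c') : (Fin (2 * L - 1 + 1) → GaugeConfig 3 L SU2) × (Site 3 L → SU2)) = 0 ∧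
      (∀ (i : Fin (2 * L - 1 + 1)) (e : Edge 3 L), fd (P.1 i e) (combFlat h' e) ≤
        4 * (L : ℝ) * Real.sqrt (ringDeficit L (fun _ => false) P) + 12 * (L : ℝ) ^ 2 * Real.sqrt (ringDeficit L (fun _ => false) P) +
          40 * (L : ℝ) ^ 2 * Real.sqrt (ringDeficit L (fun _ => false) P) / ρ) ∧
      (∀ x : Site 3 L, fd (P.2 x) c' ≤
        12 * (L : ℝ) ^ 2 * Real.sqrt (ringDeficit L (fun _ => false) P) + 40 * (L : ℝ) ^ 2 * Real.sqrt (ringDeficit L (fun _ => false) P) / ρ) ∧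
      (∑ i : Fin (2 * L - 1 + 1), (6 * (L : ℝ) ^ 3 - timeCoupling su2Rep (P.1 i) (combFlat h'))) +
          ∑ x : Site 3 L, (2 - ((su2Rep (P.2 x * c'⁻¹)).trace).re) ≤
        21520 * (L : ℝ) ^ 8 * ringDeficit L (fun _ => false) P / ρ ^ 2 := by
  have hρ1 : ρ ≤ 1 := by
    have hρ2 : ρ ^ 2 ≤ 1 := by
      rcases hfar with ⟨k, hk⟩ | h0
      · nlinarith [sq_nonneg (su2Quat (wrapReps (P.1 0) k)).re]
      · nlinarith [sq_nonneg (su2Quat (P.2 0)).re]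
    nlinarith
  have hfar' : (∃ k : Fin 3, ρ ^ 2 ≤ ((su2Quat (wrapReps (P.1 0) k)).imI * (su2Quat (wrapReps (P.1 0) k)).imI +
        (su2Quat (wrapReps (P.1 0) k)).imJ * (su2Quat (wrapReps (P.1 0) k)).imJ + (su2Quat (wrapReps (P.1 0) k)).imK * (su2Quat (wrapReps (P.1 0) k)).imK)) ∨
      ρ ^ 2 ≤ ((su2Quat (P.2 0)).imI * (su2Quat (P.2 0)).imI + (su2Quat (P.2 0)).imJ * (su2Quat (P.2 0)).imJ +
        (su2Quat (P.2 0)).imK * (su2Quat (P.2 0)).imK) := by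
    rcases hfar with ⟨k, hk⟩ | h0
    · exact Or.inl ⟨k, by rw [imDot_su2Quat_eq]; exact hk⟩
    · exact Or.inr (by rw [imDot_su2Quat_eq]; exact h0)
  obtain ⟨n₁, n₂, n₃, th, tc, h', c', hn, hh', hc', hQ0, hQ1, hQ2⟩ := exists_comb_near_of_far_axis P hρ hfar'
  -- in comb gauge the comb ring is the plain comb point
  have e1 : (fun _ : Fin (2 * L - 1 + 1) => gaugeTransform (treeGauge (P.1 0))⁻¹ (combFlat h')) = fun _ => (combFlat h' : GaugeConfig 3 L SU2) := by
    funext i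
    rw [ht, inv_one, TT.gaugeTransform_one']
  have e2 : (fun x => (treeGauge (P.1 0) x)⁻¹ * c' * treeGauge (P.1 0) x) = fun _ : Site 3 L => c' := by
    funext x
    rw [ht, Pi.one_apply, inv_one, one_mul, mul_one]
  have hQ1' : ∀ (i : Fin (2 * L - 1 + 1)) (e : Edge 3 L), fd (P.1 i e) (combFlat h' e) ≤
      4 * (L : ℝ) * Real.sqrt (ringDeficit L (fun _ => false) P) + 12 * (L : ℝ) ^ 2 * Real.sqrt (ringDeficit L (fun _ => false) P) +
        40 * (L : ℝ) ^ 2 * Real.sqrt (ringDeficit L (fun _ => false) P) / ρ := fun i e => by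
    have h := hQ1 i e
    rwa [ht, inv_one, TT.gaugeTransform_one'] at h
  have hQ2' : ∀ x : Site 3 L, fd (P.2 x) c' ≤
      12 * (L : ℝ) ^ 2 * Real.sqrt (ringDeficit L (fun _ => false) P) + 40 * (L : ℝ) ^ 2 * Real.sqrt (ringDeficit L (fun _ => false) P) / ρ := fun x => by
    have h := hQ2 x
    rwa [ht, Pi.one_apply, inv_one, one_mul, mul_one] at h
  refine ⟨n₁, n₂, n₃, th, tc, h', c', hn, hh', hc', ?_, hQ1', hQ2', ?_⟩
  · rw [e1, e2] at hQ0
    exact hQ0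
  · exact sum_dist_le_of_fd_le P (((fun _ => combFlat h'), fun _ => c')) hρ hρ1 hQ1' hQ2'

end Summit.QuantumFields.YangMills.Theorems.VirialFluxGap.RegularValley

end
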